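import Mathlib
import Summits.Ventures.PercRepro2.Defs
import Summits.Ventures.PercRepro2.Independence
import Summits.Ventures.PercRepro2.Harris
import Summits.Ventures.PercRepro2.CoinDefs
import Summits.Ventures.PercRepro2.CoinReverse
import Summits.Ventures.PercRepro2.CoinPendantDefs
import Summits.Ventures.PercRepro2.CoinTraceLevels
import Summits.Ventures.PercRepro2.CoinStarDefs
import Summits.Ventures.PercRepro2.CoinLsmCoreAlg
import Summits.Ventures.PercRepro2.CoinLsmCoreDefs

/-!
# Closed-in cores with antiparallel pairs at the root (blind cell PercRepro2, night-2 g7;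
proofs/NIGHT2-DARC.md §30.15)

`ClosedInCoreU` relaxes `ClosedInCore`: arcs INTO the root `s` are allowed as long as they come from
the core (`into_s`), so undirected cores — pairs `s ↔ v` — qualify.  The reachability lemmas, the two
partitions and the core mass decomposition go through verbatim (the only use of «nothing enters
`s`» was that a path from outside the core never enters it, which the relaxed condition gives as
well); `CoinLsmCoreU.lean` re-runs the main theorem on this interface.
-/

namespace Summit.Ventures.PercRepro2.Coin

open Classical

section CoreReachU

variable {V : Type*} {E : Type*} [DecidableEq V]

/-- A closed-in core, UNDIRECTED version: every arc into `C ∪ {s}` has its tail in `C ∪ {s}` (arcs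
into `s` from the core — antiparallel pairs at the root — are allowed); `s ∉ C`. -/
structure ClosedInCoreU (arcs : E → Finset (V × V)) (s : V) (C : Finset V) : Prop where
  into_C : ∀ e, ∀ xy ∈ arcs e, xy.2 ∈ C → xy.1 ∈ C ∨ xy.1 = s
  into_s : ∀ e, ∀ xy ∈ arcs e, xy.2 = s → xy.1 ∈ C ∨ xy.1 = s
  s_notin : s ∉ C

variable {arcs : E → Finset (V × V)} {s : V} {C : Finset V}

/-- An arc whose head is outside `C ∪ {s}` is an arc of the reduced map (`SameEnds`: a coin with
an arc into the core has all its endpoints in `C ∪ {s}`). -/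
lemma ClosedInCoreU.mem_coreOff (h : ClosedInCoreU arcs s C) (hS : SameEnds arcs) {e : E}
    {x y : V} (hxy : (x, y) ∈ arcs e) (hy : y ∉ C) (hys : y ≠ s) : (x, y) ∈ coreOff arcs C e := by
  simp only [coreOff]
  rw [if_neg]
  · exact hxy
  · intro hmem
    obtain ⟨⟨x', y'⟩, hxy', hy'⟩ := mem_coreCoins.mp hmem
    have hx' : x' ∈ C ∨ x' = s := h.into_C e _ hxy' hy'
    have hends := hS e (x', y') hxy' (x, y) hxy
    have hyin : y = x' ∨ y = y' := hends.2
    rcases hyin with rfl | rfl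
    · rcases hx' with hx' | hx'
      · exact hy hx'
      · exact hys hx'
    · exact hy hy'

/-- A path starting outside `C ∪ {s}` stays outside and lives in the reduced map. -/
lemma ClosedInCoreU.reach_outside (h : ClosedInCoreU arcs s C) (hS : SameEnds arcs) {ω : Config E}
    {x y : V} (hx : x ∉ C) (hxs : x ≠ s) (hr : Reach arcs ω x y) :
    y ∉ C ∧ y ≠ s ∧ Reach (coreOff arcs C) ω x y := by
  induction hr with
  | refl => exact ⟨hx, hxs, reach_refl _ _ _⟩
  | @tail y z _ hstep ih =>
    obtain ⟨e, he, hxy⟩ := hstep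
    have hzs : z ≠ s := by
      intro hz
      rcases h.into_s e _ hxy hz with hp | hp
      · exact ih.1 hp
      · exact ih.2.1 hp
    have hzC : z ∉ C := by
      intro hz
      rcases h.into_C e _ hxy hz with hp | hp
      · exact ih.1 hp
      · exact ih.2.1 hp
    exact ⟨hzC, hzs, reach_trans ih.2.2 (reach_of_openArc ⟨e, he, h.mem_coreOff hS hxy hzC hzs⟩)⟩

/-- Reachability from `s` to a vertex outside the core: a core vertex (or `s`) reached from `s`,
then a path of the reduced map. -/
lemma ClosedInCoreU.reach_s_iff (h : ClosedInCoreU arcs s C) (hS : SameEnds arcs) {ω : Config E}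
    {y : V} (hy : y ∉ C) (hys : y ≠ s) :
    Reach arcs ω s y ↔ ∃ v ∈ insert s C, Reach arcs ω s v ∧ Reach (coreOff arcs C) ω v y := by
  constructor
  · intro hr
    have key : ∀ {y : V}, Reach arcs ω s y → (y ∈ C ∨ y = s) ∨
        ((y ∉ C ∧ y ≠ s) ∧ ∃ v ∈ insert s C, Reach arcs ω s v ∧ Reach (coreOff arcs C) ω v y) := by
      intro y hr
      induction hr with
      | refl => exact Or.inl (Or.inr rfl)
      | @tail y z hsy hstep ih =>
        obtain ⟨e, he, hxy⟩ := hstep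
        by_cases hzs : z = s
        · exact Or.inl (Or.inr hzs)
        by_cases hzC : z ∈ C
        · exact Or.inl (Or.inl hzC)
        · refine Or.inr ⟨⟨hzC, hzs⟩, ?_⟩
          rcases ih with hcore | ⟨_, v, hv, hsv, hvy⟩
          · refine ⟨y, ?_, hsy, reach_of_openArc ⟨e, he, h.mem_coreOff hS hxy hzC hzs⟩⟩
            rcases hcore with hyC | rfl
            · exact Finset.mem_insert_of_mem hyC
            · exact Finset.mem_insert_self _ _
          · exact ⟨v, hv, hsv,
              reach_trans hvy (reach_of_openArc ⟨e, he, h.mem_coreOff hS hxy hzC hzs⟩)⟩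
    rcases key hr with hcore | ⟨_, hex⟩
    · rcases hcore with hyC | rfl
      · exact absurd hyC hy
      · exact absurd rfl hys
    · exact hex
  · rintro ⟨v, _, hsv, hvy⟩
    exact reach_trans hsv (reach_of_reach_coreOff hvy)

/-- `R_t` on a closed-in core (`t ∉ C`, `t ≠ s`): every core vertex reached from `s` — and `s`
itself — fails to reach `t` in the reduced map. -/
lemma ClosedInCoreU.avoid_iff (h : ClosedInCoreU arcs s C) (hS : SameEnds arcs) {t : V}
    (htC : t ∉ C) (hts : t ≠ s) {ω : Config E} :
    ω ∈ avoidEvent arcs s {t} ↔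
      ∀ v ∈ insert s C, Reach arcs ω s v → ¬ Reach (coreOff arcs C) ω v t := by
  simp only [avoidEvent, Set.mem_setOf_eq, Finset.mem_singleton, forall_eq]
  rw [h.reach_s_iff hS htC hts]
  constructor
  · intro hh v hv hsv hvt; exact hh ⟨v, hv, hsv, hvt⟩
  · rintro hh ⟨v, hv, hsv, hvt⟩; exact hh v hv hsv hvt

/-- The gate event of `u → w` on a closed-in core (`w ∉ C`, `w ≠ s`): `R_t`, and if `u` is reached
then `w` does not reach `t` in the reduced map. -/
lemma ClosedInCoreU.gate_iff (h : ClosedInCoreU arcs s C) (hS : SameEnds arcs) {t u w : V}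
    (hwC : w ∉ C) (hws : w ≠ s) {ω : Config E} :
    ω ∈ gateEvent arcs s {t} u w ↔
      ω ∈ avoidEvent arcs s {t} ∧ (Reach arcs ω s u → ¬ Reach (coreOff arcs C) ω w t) := by
  rw [gateEvent_eq_union]
  simp only [Set.mem_inter_iff, Set.mem_union, Set.mem_compl_iff, fwdEvent, bwdEvent,
    Set.mem_setOf_eq, Finset.mem_singleton, exists_eq_left]
  have hw : Reach arcs ω w t ↔ Reach (coreOff arcs C) ω w t :=
    ⟨fun hr => (h.reach_outside hS hwC hws hr).2.2, reach_of_reach_coreOff⟩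
  rw [hw]
  constructor
  · rintro ⟨hR, hg⟩
    refine ⟨hR, fun hsu hwt => ?_⟩
    rcases hg with hg | hg
    · exact hg hsu
    · exact hg hwt
  · rintro ⟨hR, hg⟩
    refine ⟨hR, ?_⟩
    by_cases hsu : Reach arcs ω s u
    · exact Or.inr (hg hsu)
    · exact Or.inl hsu

/-- In the reversed system the core is closed out into `s`. -/
lemma ClosedInCoreU.closedOut_rev (h : ClosedInCoreU arcs s C) : ClosedOut (revArcs arcs) C {s} := by
  intro e xy hxy hx
  rw [mem_revArcs] at hxy
  rw [Finset.mem_union, Finset.mem_singleton]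
  exact h.into_C e _ hxy hx

/-- The core levels depend on the core coins only. -/
lemma ClosedInCoreU.dependsOn_coreLevel (h : ClosedInCoreU arcs s C) (W : Finset V) :
    DependsOn (· ∈ coreLevel arcs s C W) (coreCoins arcs C) :=
  dependsOn_traceLevel h.closedOut_rev W

/-- `R_t` is the disjoint union over `W ⊆ C` of «core level `W` and `W ∪ {s}` avoids `t`». -/
theorem ClosedInCoreU.avoid_eq_biUnion (h : ClosedInCoreU arcs s C) (hS : SameEnds arcs) {t : V}
    (htC : t ∉ C) (hts : t ≠ s) :
    avoidEvent arcs s {t} =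
      ⋃ W ∈ C.powerset, coreLevel arcs s C W ∩ coreAvoidEvent arcs s t C W := by
  ext ω
  simp only [Set.mem_iUnion, Set.mem_inter_iff, exists_prop, Finset.mem_powerset]
  constructor
  · intro hω
    refine ⟨C.filter (fun v => Reach arcs ω s v), Finset.filter_subset _ _, ?_, ?_⟩
    · rw [mem_coreLevel]
      intro z hz
      simp [Finset.mem_filter, hz]
    · intro v hv
      rw [Finset.mem_insert, Finset.mem_filter] at hv
      rcases hv with rfl | ⟨hvC, hsv⟩
      · exact (h.avoid_iff hS htC hts).mp hω v (Finset.mem_insert_self _ _) (reach_refl _ _ _)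
      · exact (h.avoid_iff hS htC hts).mp hω v (Finset.mem_insert_of_mem hvC) hsv
  · rintro ⟨W, hW, hlev, hav⟩
    rw [h.avoid_iff hS htC hts]
    intro v hv hsv
    rw [Finset.mem_insert] at hv
    rcases hv with rfl | hvC
    · exact hav v (Finset.mem_insert_self _ _)
    · exact hav v (Finset.mem_insert_of_mem ((mem_coreLevel.mp hlev v hvC).mpr hsv))

/-- The gate event of `u → w` is the disjoint union over `W ⊆ C` of «core level `W` and
`starTarget u w W ∪ {s}` avoids `t`». -/
theorem ClosedInCoreU.gate_eq_biUnion (h : ClosedInCoreU arcs s C) (hS : SameEnds arcs)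
    {t u w : V} (htC : t ∉ C) (hts : t ≠ s) (hu : u ∈ C) (hwC : w ∉ C) (hws : w ≠ s) :
    gateEvent arcs s {t} u w =
      ⋃ W ∈ C.powerset, coreLevel arcs s C W ∩ coreAvoidEvent arcs s t C (starTarget u w W) := by
  ext ω
  simp only [Set.mem_iUnion, Set.mem_inter_iff, exists_prop, Finset.mem_powerset]
  rw [h.gate_iff hS hwC hws]
  constructor
  · rintro ⟨hR, hg⟩
    refine ⟨C.filter (fun v => Reach arcs ω s v), Finset.filter_subset _ _, ?_, ?_⟩
    · rw [mem_coreLevel]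
      intro z hz
      simp [Finset.mem_filter, hz]
    · intro v hv
      rw [Finset.mem_insert] at hv
      rcases hv with rfl | hv
      · exact (h.avoid_iff hS htC hts).mp hR v (Finset.mem_insert_self _ _) (reach_refl _ _ _)
      · simp only [starTarget] at hv
        split_ifs at hv with huL
        · rw [Finset.mem_insert] at hv
          rcases hv with rfl | hv
          · exact hg (Finset.mem_filter.mp huL).2
          · rw [Finset.mem_filter] at hv
            exact (h.avoid_iff hS htC hts).mp hR v (Finset.mem_insert_of_mem hv.1) hv.2
        · rw [Finset.mem_filter] at hv
          exact (h.avoid_iff hS htC hts).mp hR v (Finset.mem_insert_of_mem hv.1) hv.2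
  · rintro ⟨W, hW, hlev, hav⟩
    have hsub : W ⊆ starTarget u w W := by
      simp only [starTarget]; split_ifs
      · exact Finset.subset_insert _ _
      · exact le_rfl
    refine ⟨?_, ?_⟩
    · rw [h.avoid_iff hS htC hts]
      intro v hv hsv
      rw [Finset.mem_insert] at hv
      rcases hv with rfl | hvC
      · exact hav v (Finset.mem_insert_self _ _)
      · exact hav v (Finset.mem_insert_of_mem (hsub ((mem_coreLevel.mp hlev v hvC).mpr hsv)))
    · intro hsu
      have huW : u ∈ W := (mem_coreLevel.mp hlev u hu).mpr hsu
      apply hav w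
      simp [starTarget, huW]


end CoreReachU

section CoreMassU

variable {V : Type*} {E : Type*} [Fintype V] [DecidableEq V] [Fintype E] [DecidableEq E]
  {R : Type*} [Field R] [LinearOrder R] [IsStrictOrderedRing R]
  {arcs : E → Finset (V × V)} {s : V} {C : Finset V}

omit [Fintype V] [LinearOrder R] [IsStrictOrderedRing R] in
/-- The core mass decomposition for a `ClosedInCoreU`. -/
theorem ClosedInCoreU.core_mass (h : ClosedInCoreU arcs s C) (p : E → R) (t : V)
    (X : Finset V → Finset V) {f : Config E → R} {g : Finset V → R}
    (hfg : ∀ W ⊆ C, ∀ ω ∈ coreLevel arcs s C W, f ω = g W) :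
    massE p f (⋃ W ∈ C.powerset, coreLevel arcs s C W ∩ coreAvoidEvent arcs s t C (X W)) =
      ∑ W ∈ C.powerset, g W * (prob p (coreLevel arcs s C W) *
        prob p (coreAvoidEvent arcs s t C (X W))) := by
  rw [massE_biUnion p f C.powerset
    (fun W => coreLevel arcs s C W ∩ coreAvoidEvent arcs s t C (X W))
    (by unfold coreLevel; exact pairwiseDisjoint_levels_powerset _)]
  refine Finset.sum_congr rfl fun W hW => ?_
  have hW' : W ⊆ C := Finset.mem_powerset.mp hW
  rw [massE_congr' p (g := fun _ => g W) (fun ω hω => hfg W hW' ω hω.1), star_massE_const,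
    prob_inter_eq_mul_of_dependsOn p disjoint_compl_right (h.dependsOn_coreLevel W)
      (dependsOn_coreAvoid t (X W))]

end CoreMassU

end Summit.Ventures.PercRepro2.Coin
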